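import Summits.AtomisticToContinuum.HydrodynamicLimit.Theorems.CollisionIsometryCLTCollisionalTransferLocalityDefs
import Literature.Analysis.FluidPDE.CollisionalTransferTimeDep
import HarnessLib

/-!
# The balance identity [S1] of the line `hemisphere-affine-slaving` (stub `stub_balanceIdentity`)

Registered stub `stub_balanceIdentity` of the crux `CollisionalTransferLocality`
(stmt-AtomisticToContinuum-9518; vocabulary `Theorems/CollisionIsometryCLTCollisionalTransferLocalityDefs`):
for `0 < σ ≤ 1/2`, every flow family `Φ`, `N`, `t > 0`, tests `ψ, χ` smooth on `[0, t] × 𝕋³`, good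
datum `z` and `τ ∈ [0, t]`, the crux's Irving–Kirkwood residual `Cc` IS the normalised jump sum
`Jfun = (N+1)⁻¹ Σ_{t_c ∈ (0, τ]} Σ_{(i,j) ∈ contactPairs} [ψ(x_i)·Δv_i + χ(x_i) Δ|v_i|²/2]`: the weak
balance law of Spohn 1991, Part I §3.2 (3.3)–(3.8), for a time-dependent observable along ONE
hard-sphere trajectory. The tree's `sub_eq_integral_add_finsum_collisionJump_td` asks GLOBAL-in-time
derivatives while the tests are smooth on `[0, t]` only, so we (1) re-prove the law localized to a
window (adapted from `Literature/Analysis/FluidPDE/CollisionalTransferTimeDep`: FTC with interior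
derivatives, one-sided continuity, interval integrability), (2) supply its analytic inputs for
`F s w = Obs ψ χ N s w` from the joint smoothness of `(s, r) ↦ Obs ψ χ N s (S_r w)` on `[0, t] × ℝ`
(space–time lifts; `d/ds = ∂ₛ + ∂ᵣ`), (3) identify the jump at a binary collision with the
`jumpK`-sum over the two ordered contact pairs (positions and the other particles do not jump; the
pre-collisional velocity is the `reflectVel` read-off; contact is symmetric on the torus, so no
regularity of the geometry and no separate case `N = 0` is needed).
References: H. Spohn, *Large Scale Dynamics of Interacting Particles* (1991), Part I §3.2
[Spohn1991]; R. Soto, *Kinetic Theory and Transport Phenomena* (2016), §4.8.1 [Soto2016].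
-/

namespace Summit.AtomisticToContinuum.HydrodynamicLimit.Theorems.HemisphereAffineSlaving

open scoped BigOperators Topology Manifold Classical MeasureTheory ProbabilityTheory Matrix InnerProductSpace ComplexConjugate ContinuousMap ENNReal
open Filter Set Function TopologicalSpace MeasureTheory

noncomputable section

open Literature.MathematicalPhysics.KineticTheory (T3 V3)
open Literature.Analysis.FluidPDE Literature.Analysis.FunctionSpaces

namespace BalanceIdentity

/-! ## The localized weak balance law for a time-dependent observable -/

section LocalBalance

-- adapted from Literature/Analysis/FluidPDE/CollisionalTransferTimeDep.lean (global-in-time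
-- hypotheses replaced by hypotheses on a window `[A, B]`)

variable {d : Type*} [Fintype d] {X : Type*} [TopologicalSpace X] [T2Space X] {n : ℕ}
  {E : Type*} [NormedAddCommGroup E] [NormedSpace ℝ E] [CompleteSpace E]
  {G : Geometry d X} {ε : ℝ} {γ : ℝ → Config n d X} {F F' : ℝ → Config n d X → E} {A B : ℝ}
  (h : IsHardSphereTrajectory G ε n γ) (hG : ∀ x : X, Continuous (G.translate x))
  (hF : ∀ (z : Config n d X) (t₀ : ℝ), ∀ s ∈ Ioo A B,
    HasDerivAt (fun s => F s (freeFlight G (s - t₀) z)) (F' s (freeFlight G (s - t₀) z)) s)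
  (hFc : ∀ (z : Config n d X) (t₀ : ℝ), ContinuousOn (fun s => F s (freeFlight G (s - t₀) z)) (Icc A B))
  (hF'i : ∀ (z : Config n d X) (t₀ : ℝ),
    IntervalIntegrable (fun s => F' s (freeFlight G (s - t₀) z)) volume A B)

include h hG hF hFc hF'i

/-- FTC on a collision-free stretch `(a, T)` inside the window `[A, B]`: `s ↦ F' s (γ s)` is
integrable on `[a, T]` and `F T (γ(T⁻)) - F a (γ a) = ∫_a^T F' s (γ s) ds`. [folklore] -/
theorem leftLim_sub_eq_integral_of_Ioo_free_loc {a T : ℝ} (hAa : A ≤ a) (haT : a < T) (hTB : T ≤ B)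
    (hfree : ∀ σ ∈ Ioo a T, σ ∉ collisionTimes G ε γ) :
    IntervalIntegrable (fun s => F' s (γ s)) volume a T ∧
      F T (leftLim γ T) - F a (γ a) = ∫ s in a..T, F' s (γ s) := by
  have hAB : A ≤ B := hAa.trans (haT.le.trans hTB)
  have hderiv : ∀ s ∈ Ioo a T, HasDerivAt (fun s => F s (freeFlight G (s - a) (γ a)))
      (F' s (freeFlight G (s - a) (γ a))) s := fun s hs =>
    hF (γ a) a s ⟨hAa.trans_lt hs.1, hs.2.trans_le hTB⟩
  have hcont : ContinuousOn (fun s => F s (freeFlight G (s - a) (γ a))) (Icc a T) :=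
    (hFc (γ a) a).mono (Icc_subset_Icc hAa hTB)
  have hint : IntervalIntegrable (fun s => F' s (freeFlight G (s - a) (γ a))) volume a T :=
    (hF'i (γ a) a).mono_set
      (by rw [uIcc_of_le haT.le, uIcc_of_le hAB]; exact Icc_subset_Icc hAa hTB)
  have heq : EqOn (fun s => F' s (freeFlight G (s - a) (γ a))) (fun s => F' s (γ s)) (Ioo a T) :=
    fun s hs => congrArg (F' s) (h.eq_freeFlight_of_Ioo_free hfree ⟨hs.1.le, hs.2⟩).symm
  refine ⟨hint.congr_uIoo (by rwa [uIoo_of_le haT.le]), ?_⟩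
  rw [← intervalIntegral.integral_congr_Ioo_of_le haT.le heq,
    intervalIntegral.integral_eq_sub_of_hasDerivAt_of_le haT.le hcont hderiv hint,
    h.leftLim_eq_freeFlight hG haT hfree, sub_self, freeFlight_zero]

/-- **The localized weak balance law for a time-dependent observable along a hard-sphere
trajectory**: if along every free flight `s ↦ F s (S_{s-t₀} z)` is continuous on `[A, B]` with
derivative `F' s (S_{s-t₀} z)` at interior times, the latter interval integrable on `[A, B]`,
then on every `[a, b] ⊆ [A, B]`, `s ↦ F' s (γ s)` is interval integrable and
`F b (γ b) - F a (γ a) = ∫_a^b F' s (γ s) ds + Σᶠ_{t ∈ C ∩ (a, b]} [F t (γ t) - F t (γ t⁻)]`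
(Spohn 1991, Part I §3.2 (3.3)–(3.8), against tests smooth on a compact window; induction on the
number of collision times in `(a, b]`). [folklore] -/
theorem sub_eq_integral_add_finsum_collisionJump_loc {a b : ℝ} (hAa : A ≤ a) (hab : a ≤ b) (hbB : b ≤ B) :
    IntervalIntegrable (fun s => F' s (γ s)) volume a b ∧
      F b (γ b) - F a (γ a) = (∫ s in a..b, F' s (γ s)) +
        ∑ᶠ t ∈ collisionTimes G ε γ ∩ Ioc a b, collisionJump (F t) γ t := by
  classical
  suffices H : ∀ (m : ℕ) (a : ℝ), A ≤ a → a ≤ b →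
      (h.finite_collisionTimes_inter_Ioc a b).toFinset.card = m →
      IntervalIntegrable (fun s => F' s (γ s)) volume a b ∧
        F b (γ b) - F a (γ a) = (∫ s in a..b, F' s (γ s)) +
          ∑ᶠ t ∈ collisionTimes G ε γ ∩ Ioc a b, collisionJump (F t) γ t from
    H _ a hAa hab rfl
  intro m
  induction m with
  | zero =>
    intro a hAa hab hcard
    rw [Finset.card_eq_zero] at hcard
    have hfree : ∀ σ ∈ Ioc a b, σ ∉ collisionTimes G ε γ := fun σ hσ hcol =>
      Finset.notMem_empty σ (hcard ▸ (Set.Finite.mem_toFinset _).2 ⟨hcol, hσ⟩)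
    have hempty : collisionTimes G ε γ ∩ Ioc a b = ∅ :=
      Set.eq_empty_iff_forall_notMem.2 fun t ht => hfree t ht.2 ht.1
    rw [hempty, finsum_mem_empty, add_zero]
    rcases hab.eq_or_lt with rfl | hab'
    · simp
    -- no collision in `(a, b]`: FTC on the free stretch, and `γ b⁻ = γ b`
    obtain ⟨hint, heq⟩ := leftLim_sub_eq_integral_of_Ioo_free_loc h hG hF hFc hF'i hAa hab' hbB
      fun σ hσ => hfree σ ⟨hσ.1, hσ.2.le⟩
    rw [h.leftLim_eq_of_not_mem hG (hfree b ⟨hab', le_rfl⟩)] at heq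
    exact ⟨hint, heq⟩
  | succ m ih =>
    intro a hAa hab hcard
    set S := (h.finite_collisionTimes_inter_Ioc a b).toFinset with hS
    have hne : S.Nonempty := Finset.card_pos.1 (by omega)
    have hTmem : S.min' hne ∈ collisionTimes G ε γ ∩ Ioc a b :=
      (Set.Finite.mem_toFinset _).1 (S.min'_mem hne)
    set T := S.min' hne with hT
    have haT : a < T := hTmem.2.1
    have hTb : T ≤ b := hTmem.2.2
    have hmemS : ∀ {σ}, σ ∈ collisionTimes G ε γ → a < σ → σ ≤ b → σ ∈ S := fun hσ haσ hσb =>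
      (Set.Finite.mem_toFinset _).2 ⟨hσ, haσ, hσb⟩
    have hfree : ∀ σ ∈ Ioo a T, σ ∉ collisionTimes G ε γ := fun σ hσ hcol =>
      (not_lt.2 (S.min'_le σ (hmemS hcol hσ.1 (hσ.2.le.trans hTb)))) hσ.2
    have hcard' : (h.finite_collisionTimes_inter_Ioc T b).toFinset.card = m := by
      have hE : (h.finite_collisionTimes_inter_Ioc T b).toFinset = S.erase T := by
        ext σ
        simp only [Set.Finite.mem_toFinset, Finset.mem_erase, mem_inter_iff, mem_Ioc]
        constructor
        · rintro ⟨hσ, hTσ, hσb⟩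
          exact ⟨hTσ.ne', hmemS hσ (haT.trans hTσ) hσb⟩
        · rintro ⟨hne', hσS⟩
          obtain ⟨hσ, haσ, hσb⟩ := (Set.Finite.mem_toFinset _).1 hσS
          exact ⟨hσ, lt_of_le_of_ne (S.min'_le σ hσS) (Ne.symm hne'), hσb⟩
      rw [hE, Finset.card_erase_of_mem (S.min'_mem hne), hcard]
      rfl
    obtain ⟨hint₂, heq₂⟩ := ih T (hAa.trans haT.le) hTb hcard'
    obtain ⟨hint₁, heq₁⟩ :=
      leftLim_sub_eq_integral_of_Ioo_free_loc h hG hF hFc hF'i hAa haT (hTb.trans hbB) hfree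
    refine ⟨hint₁.trans hint₂, ?_⟩
    rw [← intervalIntegral.integral_add_adjacent_intervals hint₁ hint₂,
      ← h.finsum_collisionJump_td_add_adjacent F haT.le hTb,
      IsHardSphereTrajectory.finsum_collisionJump_td_eq F haT hTmem.1 hfree, collisionJump,
      ← heq₁]
    have e : F b (γ b) - F a (γ a) = F T (leftLim γ T) - F a (γ a) +
        (F T (γ T) - F T (leftLim γ T)) + (F b (γ b) - F T (γ T)) := by abel
    rw [e, heq₂]
    abel

end LocalBalance

/-! ## The tested observable of the crux: finite sum, time derivative, joint smoothness -/

section Observable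

variable {t : ℝ} {ψ : ℝ → T3 → V3} {χ : ℝ → T3 → ℝ}

/-- The crux's tested observable against the empirical measure is the normalised finite sum
`Obs ψ χ N s w = (N+1)⁻¹ Σ_i [Σ_j ψ(s, x_i)_j v_{ij} + χ(s, x_i) |v_i|²/2]`
(`integral_empiricalMeasure`). [folklore] -/
theorem Obs_eq_sum (ψ : ℝ → T3 → V3) (χ : ℝ → T3 → ℝ) (N : ℕ) (s : ℝ) (w : Cfg N) :
    Obs ψ χ N s w = ((N : ℝ) + 1)⁻¹ *
      ∑ i, ((∑ j, ψ s (w i).1 j * (w i).2 j) + χ s (w i).1 * (‖(w i).2‖ ^ 2 / 2)) := by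
  rw [Obs, integral_empiricalMeasure]
  push_cast
  rfl

/-- Each translation `v ↦ x + proj v` of the torus geometry is continuous. [folklore] -/
theorem torus_continuous_translate (x : T3) : Continuous ((Torus.geometry (Fin 3)).translate x) :=
  continuous_const.add Torus.continuous_proj

/-- At an interior time of the window, `τ ↦ g τ x` has derivative `Torus.timeDeriv g s x` (the
space–time lift is differentiable there). [folklore] -/
theorem hasDerivAt_timeDeriv {F : Type*} [NormedAddCommGroup F] [NormedSpace ℝ F]
    {g : ℝ → T3 → F} (hg : Torus.IsSmoothSpaceTimeOn (Icc 0 t) g) {s : ℝ} (hs : s ∈ Ioo 0 t)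
    (x : T3) : HasDerivAt (fun τ => g τ x) (Torus.timeDeriv g s x) s := by
  have h1 : (fun τ => g τ x) = Torus.stLift g ∘ fun τ => (τ, Torus.repr x) := by
    funext τ; simp [Torus.proj_repr]
  have hd : DifferentiableAt ℝ (fun τ => g τ x) s := by
    rw [h1]
    exact ((hg.contDiffAt (prod_mem_nhds (Icc_mem_nhds hs.1 hs.2) univ_mem)).differentiableAt
      (by simp)).comp s (by fun_prop)
  exact hd.hasDerivAt

/-- **The explicit time derivative of the tested observable** at a frozen configuration and an
interior time: `d/ds Obs ψ χ N s w = Obs (∂ₛψ) (∂ₛχ) N s w`. [folklore] -/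
theorem hasDerivAt_Obs_time (hψ : Torus.IsSmoothSpaceTimeOn (Icc 0 t) ψ)
    (hχ : Torus.IsSmoothSpaceTimeOn (Icc 0 t) χ) {s : ℝ} (hs : s ∈ Ioo 0 t) (N : ℕ) (w : Cfg N) :
    HasDerivAt (fun s' => Obs ψ χ N s' w)
      (Obs (Torus.timeDeriv ψ) (Torus.timeDeriv χ) N s w) s := by
  simp only [Obs_eq_sum]
  refine HasDerivAt.const_mul _ (HasDerivAt.fun_sum fun i _ => ?_)
  refine (HasDerivAt.fun_sum fun j _ => ?_).add ((hasDerivAt_timeDeriv hχ hs _).mul_const _)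
  have h := (EuclideanSpace.proj j : V3 →L[ℝ] ℝ).hasFDerivAt.comp_hasDerivAt s
    (hasDerivAt_timeDeriv hψ hs (w i).1)
  exact (by simpa [Function.comp_def] using h : HasDerivAt (fun τ => ψ τ (w i).1 j)
    (Torus.timeDeriv ψ s (w i).1 j) s).mul_const _

/-- **Joint smoothness** of `(s, r) ↦ Obs ψ χ N s (S_r w)` on `[0, t] × ℝ`: in the lift it is a
finite sum of smooth-on-the-window functions `stLift ψ`, `stLift χ` of affine maps. [folklore] -/
theorem contDiffOn_Obs_freeFlight (hψ : Torus.IsSmoothSpaceTimeOn (Icc 0 t) ψ)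
    (hχ : Torus.IsSmoothSpaceTimeOn (Icc 0 t) χ) (N : ℕ) (w : Cfg N) :
    ContDiffOn ℝ (⊤ : ℕ∞) (fun p : ℝ × ℝ => Obs ψ χ N p.1 (freeFlight (Torus.geometry (Fin 3)) p.2 w))
      (Icc 0 t ×ˢ (univ : Set ℝ)) := by
  have hexp : (fun p : ℝ × ℝ => Obs ψ χ N p.1 (freeFlight (Torus.geometry (Fin 3)) p.2 w)) =
      fun p : ℝ × ℝ => ((N : ℝ) + 1)⁻¹ * ∑ i,
        ((∑ j, Torus.stLift ψ (p.1, Torus.repr (w i).1 + p.2 • (w i).2) j * (w i).2 j) +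
          Torus.stLift χ (p.1, Torus.repr (w i).1 + p.2 • (w i).2) * (‖(w i).2‖ ^ 2 / 2)) := by
    funext p
    simp only [Obs_eq_sum, freeFlight_apply, Torus.geometry_translate, Torus.stLift_apply,
      Torus.proj_add, Torus.proj_repr]
  rw [hexp]
  refine contDiffOn_const.mul (ContDiffOn.sum fun i _ => ?_)
  have hA : ContDiff ℝ (⊤ : ℕ∞) fun p : ℝ × ℝ => (p.1, Torus.repr (w i).1 + p.2 • (w i).2) := by fun_prop
  have hmaps : MapsTo (fun p : ℝ × ℝ => (p.1, Torus.repr (w i).1 + p.2 • (w i).2))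
      (Icc 0 t ×ˢ (univ : Set ℝ)) (Icc 0 t ×ˢ (univ : Set V3)) := fun p hp => ⟨hp.1, mem_univ _⟩
  refine (ContDiffOn.sum fun j _ => ?_).add ((hχ.comp hA.contDiffOn hmaps).mul contDiffOn_const)
  exact ((EuclideanSpace.proj j).contDiff.comp_contDiffOn (hψ.comp hA.contDiffOn hmaps)).mul
    contDiffOn_const

/-- **The streaming chain rule.** At an interior time, along a free flight with absolute time,
`s ↦ Obs ψ χ N s (S_{s-t₀} w)` has derivative `Obs (∂ₛψ) (∂ₛχ) N s (S_{s-t₀} w) +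
d/dr|₀ Obs ψ χ N s (S_r (S_{s-t₀} w))` (`d/ds = ∂ₛ + ∂ᵣ`, `S_{r+r₀} = S_r S_{r₀}`), which is the
Fréchet derivative of `(s, r) ↦ Obs ψ χ N s (S_r w)` at `(s, s - t₀)` applied to `(1, 1)`. [folklore] -/
theorem hasDerivAt_Obs_freeFlight (hψ : Torus.IsSmoothSpaceTimeOn (Icc 0 t) ψ)
    (hχ : Torus.IsSmoothSpaceTimeOn (Icc 0 t) χ) (N : ℕ) (w : Cfg N) (t₀ : ℝ) {s : ℝ}
    (hs : s ∈ Ioo 0 t) :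
    HasDerivAt (fun s' => Obs ψ χ N s' (freeFlight (Torus.geometry (Fin 3)) (s' - t₀) w))
      (fderiv ℝ (fun p : ℝ × ℝ => Obs ψ χ N p.1 (freeFlight (Torus.geometry (Fin 3)) p.2 w))
        (s, s - t₀) (1, 1)) s ∧
    fderiv ℝ (fun p : ℝ × ℝ => Obs ψ χ N p.1 (freeFlight (Torus.geometry (Fin 3)) p.2 w)) (s, s - t₀) (1, 1) =
      Obs (Torus.timeDeriv ψ) (Torus.timeDeriv χ) N s (freeFlight (Torus.geometry (Fin 3)) (s - t₀) w) +
        deriv (fun r : ℝ => Obs ψ χ N s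
          (freeFlight (Torus.geometry (Fin 3)) r (freeFlight (Torus.geometry (Fin 3)) (s - t₀) w))) 0 := by
  set P : ℝ × ℝ → ℝ := fun p => Obs ψ χ N p.1 (freeFlight (Torus.geometry (Fin 3)) p.2 w) with hP
  have hd : ∀ r : ℝ, DifferentiableAt ℝ P (s, r) := fun r =>
    ((contDiffOn_Obs_freeFlight hψ hχ N w).contDiffAt
      (prod_mem_nhds (Icc_mem_nhds hs.1 hs.2) univ_mem)).differentiableAt (by simp)
  set r₀ : ℝ := s - t₀ with hr₀
  set L := fderiv ℝ P (s, r₀) with hL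
  -- total derivative along `s ↦ (s, s - t₀)` and the two partial derivatives
  have hA1 : HasDerivAt (fun s' : ℝ => (s', s' - t₀)) ((1 : ℝ), (1 : ℝ)) s :=
    (hasDerivAt_id s).prodMk ((hasDerivAt_id s).sub_const t₀)
  have hA2 : HasDerivAt (fun s' : ℝ => (s', r₀)) ((1 : ℝ), (0 : ℝ)) s :=
    (hasDerivAt_id s).prodMk (hasDerivAt_const s r₀)
  have hA3 : HasDerivAt (fun r : ℝ => (s, r)) ((0 : ℝ), (1 : ℝ)) r₀ :=
    (hasDerivAt_const r₀ s).prodMk (hasDerivAt_id r₀)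
  -- (stated with `P` unfolded, so that the uniqueness / `deriv` lemmas below unify syntactically)
  have h1' : HasDerivAt (fun s' => Obs ψ χ N s' (freeFlight (Torus.geometry (Fin 3)) (s' - t₀) w))
      (L (1, 1)) s := by exact (hd r₀).hasFDerivAt.comp_hasDerivAt s hA1
  have h2' : HasDerivAt (fun s' => Obs ψ χ N s' (freeFlight (Torus.geometry (Fin 3)) r₀ w)) (L (1, 0)) s := by
    exact (hd r₀).hasFDerivAt.comp_hasDerivAt s hA2
  have h3' : HasDerivAt (fun r => Obs ψ χ N s (freeFlight (Torus.geometry (Fin 3)) r w)) (L (0, 1)) r₀ := by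
    exact (hd r₀).hasFDerivAt.comp_hasDerivAt r₀ hA3
  have e2 : L (1, 0) =
      Obs (Torus.timeDeriv ψ) (Torus.timeDeriv χ) N s (freeFlight (Torus.geometry (Fin 3)) r₀ w) :=
    h2'.unique (hasDerivAt_Obs_time hψ hχ hs N _)
  have e3 : L (0, 1) = deriv (fun r : ℝ => Obs ψ χ N s
      (freeFlight (Torus.geometry (Fin 3)) r (freeFlight (Torus.geometry (Fin 3)) r₀ w))) 0 := by
    simp only [← freeFlight_add]
    rw [deriv_comp_add_const (fun r => Obs ψ χ N s (freeFlight (Torus.geometry (Fin 3)) r w)) r₀ 0, zero_add,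
      h3'.deriv]
  have e1 : L (1, 1) = L (1, 0) + L (0, 1) := by
    rw [← map_add, Prod.mk_add_mk, add_zero, zero_add]
  refine ⟨h1', ?_⟩
  rw [e1, e2, e3]

/-- Interval integrability on `[0, t]` of the streaming derivative along a free flight: on
`(0, t)` it is the within-window Fréchet derivative along `s ↦ (s, s - t₀)`, continuous on
`[0, t]`. [folklore] -/
theorem intervalIntegrable_Obs_freeFlight (ht : 0 < t) (hψ : Torus.IsSmoothSpaceTimeOn (Icc 0 t) ψ)
    (hχ : Torus.IsSmoothSpaceTimeOn (Icc 0 t) χ) (N : ℕ) (w : Cfg N) (t₀ : ℝ) :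
    IntervalIntegrable (fun s => Obs (Torus.timeDeriv ψ) (Torus.timeDeriv χ) N s
        (freeFlight (Torus.geometry (Fin 3)) (s - t₀) w) +
      deriv (fun r : ℝ => Obs ψ χ N s
        (freeFlight (Torus.geometry (Fin 3)) r (freeFlight (Torus.geometry (Fin 3)) (s - t₀) w))) 0) volume 0 t := by
  set P : ℝ × ℝ → ℝ := fun p => Obs ψ χ N p.1 (freeFlight (Torus.geometry (Fin 3)) p.2 w) with hP
  set S : Set (ℝ × ℝ) := Icc 0 t ×ˢ (univ : Set ℝ) with hS
  have hU : UniqueDiffOn ℝ S := (uniqueDiffOn_Icc ht).prod uniqueDiffOn_univ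
  have hcont : ContinuousOn (fderivWithin ℝ P S) S :=
    (contDiffOn_Obs_freeFlight hψ hχ N w).continuousOn_fderivWithin hU (by simp)
  have hA : Continuous fun s : ℝ => (s, s - t₀) := by fun_prop
  have hg : ContinuousOn (fun s => fderivWithin ℝ P S (s, s - t₀) ((1 : ℝ), (1 : ℝ))) (Icc 0 t) :=
    (hcont.comp hA.continuousOn fun s hs => ⟨hs, mem_univ _⟩).clm_apply continuousOn_const
  have hgi : IntegrableOn (fun s => fderivWithin ℝ P S (s, s - t₀) ((1 : ℝ), (1 : ℝ))) (Ioo 0 t) :=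
    (intervalIntegrable_iff_integrableOn_Ioo_of_le ht.le).1 (hg.intervalIntegrable_of_Icc ht.le)
  refine (intervalIntegrable_iff_integrableOn_Ioo_of_le ht.le).2
    (hgi.congr_fun (fun s hs => ?_) measurableSet_Ioo)
  have hnhds : S ∈ 𝓝 (s, s - t₀) := prod_mem_nhds (Icc_mem_nhds hs.1 hs.2) univ_mem
  show fderivWithin ℝ P S (s, s - t₀) ((1 : ℝ), (1 : ℝ)) = _
  rw [fderivWithin_of_mem_nhds hnhds]
  exact (hasDerivAt_Obs_freeFlight hψ hχ N w t₀ hs).2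

end Observable

/-! ## The jump of the tested observable at a binary collision -/

section Jump

variable {N : ℕ} {ε : ℝ} {γ : ℝ → Cfg N}
  (h : IsHardSphereTrajectory (Torus.geometry (Fin 3)) ε (N + 1) γ)
include h

/-- The jump of particle `i`'s term of the observable at a collision of the ordered contact pair
`(i, j)` is `jumpK … i j` (positions do not jump; the pre-collisional velocity is the `reflectVel`
read-off, `IsHardSphereTrajectory.ofConfig_preVel_eq_leftLim`). [folklore] -/
theorem obs_sub_leftLim_eq_jumpK {tc : ℝ} {i j : Fin (N + 1)}
    (hp : (i, j) ∈ contactPairs (Torus.geometry (Fin 3)) ε (γ tc)) (ψ : ℝ → T3 → V3) (χ : ℝ → T3 → ℝ)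
    (s : ℝ) :
    ((∑ k, ψ s (γ tc i).1 k * (γ tc i).2 k) + χ s (γ tc i).1 * (‖(γ tc i).2‖ ^ 2 / 2)) -
      ((∑ k, ψ s (leftLim γ tc i).1 k * (leftLim γ tc i).2 k) +
        χ s (leftLim γ tc i).1 * (‖(leftLim γ tc i).2‖ ^ 2 / 2)) =
      jumpK ψ χ N s (γ tc) i j := by
  have hv : (reflectVel ((Torus.geometry (Fin 3)).sepVec (γ tc i).1 (γ tc j).1)
      ((γ tc i).2, (γ tc j).2)).1 = (leftLim γ tc i).2 := by
    have := congrArg Prod.fst (h.ofConfig_preVel_eq_leftLim hp)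
    simpa only [HardSphereCollisionRecord.ofConfig_preVel] using this
  have hpos : (leftLim γ tc i).1 = (γ tc i).1 := h.leftLim_apply_fst torus_continuous_translate tc i
  simp only [jumpK, dV, dE, hv, hpos]
  rw [real_inner_comm]
  simp only [PiLp.inner_apply, RCLike.inner_apply, conj_trivial, PiLp.sub_apply, mul_sub,
    Finset.sum_sub_distrib]
  ring

/-- **The jump of the tested observable at a collision time** is `(N+1)⁻¹` times the `jumpK`-sum
over the ordered contact pairs — the two orders of the colliding pair (contact is symmetric on
the torus; collisions are binary); the other particles do not jump. [folklore] -/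
theorem collisionJump_Obs {tc : ℝ} (htc : tc ∈ collisionTimes (Torus.geometry (Fin 3)) ε γ)
    (ψ : ℝ → T3 → V3) (χ : ℝ → T3 → ℝ) (s : ℝ) : collisionJump (Obs ψ χ N s) γ tc =
      ((N : ℝ) + 1)⁻¹ *
        ∑ p ∈ contactPairs (Torus.geometry (Fin 3)) ε (γ tc), jumpK ψ χ N s (γ tc) p.1 p.2 := by
  obtain ⟨p, q, hpq, hc⟩ := htc
  have hpq_mem : (p, q) ∈ contactPairs (Torus.geometry (Fin 3)) ε (γ tc) := mem_contactPairs.2 ⟨hpq, hc⟩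
  have hqp_mem : (q, p) ∈ contactPairs (Torus.geometry (Fin 3)) ε (γ tc) := by
    refine mem_contactPairs.2 ⟨Ne.symm hpq, hc.1, ?_⟩
    rw [Torus.norm_geometry_sepVec, Torus.euclidDist_comm, ← Torus.norm_geometry_sepVec]
    exact hc.2
  have hpairs : contactPairs (Torus.geometry (Fin 3)) ε (γ tc) = {(p, q), (q, p)} := by
    ext e
    rw [Finset.mem_insert, Finset.mem_singleton]
    exact ⟨h.eq_or_eq_of_mem_contactPairs hpq_mem, by rintro (rfl | rfl) <;> assumption⟩
  have hne : (p, q) ≠ (q, p) := fun he => hpq (Prod.mk.inj he).1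
  rw [hpairs, Finset.sum_pair hne, collisionJump, Obs_eq_sum, Obs_eq_sum, ← mul_sub,
    ← Finset.sum_sub_distrib, Fintype.sum_eq_add p q hpq]
  · rw [obs_sub_leftLim_eq_jumpK h hpq_mem, obs_sub_leftLim_eq_jumpK h hqp_mem]
  · intro k hk
    rw [h.apply_eq_leftLim_apply_of_ne hpq hc hk.1 hk.2, sub_self]

end Jump

end BalanceIdentity

open BalanceIdentity in
/-- **Registered stub `stub_balanceIdentity`** of crux stmt-AtomisticToContinuum-9518 (line
hemisphere-affine-slaving): the BALANCE IDENTITY [S1]. For `0 < σ ≤ 1/2`, every flow family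
`Φ`, every `N`, `t > 0`, space–time tests `ψ, χ` smooth on `[0, t]`, every good datum `z` and
every `τ ∈ [0, t]`: `Cc σ Φ ψ χ N z τ = Jfun σ Φ ψ χ N z τ` — the crux's Irving–Kirkwood residual
is the normalised collision-jump sum over the ordered contact pairs with collision times in
`(0, τ]` (weak balance law of Spohn 1991, Part I §3.2 (3.3)–(3.8), along one trajectory,
localized to the window, the jumps rewritten pair by pair). [folklore] -/
theorem stub_balanceIdentity : ∀ σ : ℝ, 0 < σ → σ ≤ 1 / 2 → ∀ Φ : Flows σ, BalanceFor σ Φ := by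
  intro σ _hσ _hσ' Φ N t ht ψ χ hψ hχ z hz τ hτ
  have htraj := (Φ N).isTrajectory z hz
  -- the localized balance law for `F s w = Obs ψ χ N s w` on the window `[0, t]`, at `[0, τ]`
  obtain ⟨-, hbal⟩ := sub_eq_integral_add_finsum_collisionJump_loc htraj torus_continuous_translate
    (F := fun s w => Obs ψ χ N s w)
    (F' := fun s w => (∫ y, ((∑ j, Torus.timeDeriv ψ s y.1 j * y.2 j) +
        Torus.timeDeriv χ s y.1 * (‖y.2‖ ^ 2 / 2)) ∂(empiricalMeasure w)) +
      deriv (fun r : ℝ => Obs ψ χ N s (freeFlight (Torus.geometry (Fin 3)) r w)) 0) (A := 0) (B := t)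
    (fun w t₀ s hs => by
      obtain ⟨h1, h2⟩ := hasDerivAt_Obs_freeFlight hψ hχ N w t₀ hs
      exact h2 ▸ h1)
    (fun w t₀ => by
      have hA : Continuous fun s : ℝ => (s, s - t₀) := by fun_prop
      have h2 : ContinuousOn ((fun p : ℝ × ℝ => Obs ψ χ N p.1 (freeFlight (Torus.geometry (Fin 3)) p.2 w))
          ∘ fun s : ℝ => (s, s - t₀)) (Icc 0 t) :=
        (contDiffOn_Obs_freeFlight hψ hχ N w).continuousOn.comp hA.continuousOn
          fun s hs => ⟨hs, mem_univ _⟩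
      exact h2)
    (fun w t₀ => intervalIntegrable_Obs_freeFlight ht hψ hχ N w t₀) le_rfl hτ.1 hτ.2
  have hfin := htraj.finite_collisionTimes_inter_Ioc 0 τ
  -- the crux integrates over `Icc 0 τ`; its integrand is `F' s (Φ_s z)` verbatim
  unfold Cc Jfun
  rw [integral_Icc_eq_integral_Ioc, ← intervalIntegral.integral_of_le hτ.1, hbal,
    add_sub_cancel_left, HardSphereFlow.collisionPairSum,
    collisionPairSum_eq_finset_sum hfin, finsum_mem_eq_finite_toFinset_sum _ hfin, Finset.mul_sum]
  refine Finset.sum_congr rfl fun tc htc => ?_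
  exact collisionJump_Obs htraj ((Set.Finite.mem_toFinset hfin).1 htc).1 ψ χ tc

end

end Summit.AtomisticToContinuum.HydrodynamicLimit.Theorems.HemisphereAffineSlaving
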